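import Summits.BirchSwinnertonDyer.BirchSwinnertonDyer.Theorems.BiquadraticEisensteinDescentEisensteinHeartFlatCMInertBadKPrimeSqrtEndomorphismTwist
import HarnessLib

set_option linter.dupNamespace false -- `Summit.BirchSwinnertonDyer.BirchSwinnertonDyer.Theorems.…` (summit = sub)
set_option autoImplicit false

/-!
# Crux `EisensteinHeartFlatCMInertBadKPrime` (stmt-BirchSwinnertonDyer-21341), line `hsieh-lambda`, stub `stub_sqrtEndomorphism` —
# the CM endomorphisms `[i]` (`j = 1728`) and `[√-3]` (`j = 0`) in Galois sign form on EVERY elliptic curve with that `j`-invariant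
# over a field `K` of characteristic `0` not containing `i` (resp. `√-3`)

Route `BiquadraticEisensteinDescent` (cell `pub/bsd-wall`, width-prover seat `bsd-wall-cm-bed-w4` g7). Companion of
`…SqrtEndomorphismTwist` (w1 g5), which discharges the `[√d_K]`-datum of the registered stub `stub_sqrtEndomorphism` for the seven
certified `j`-invariants `≠ 0, 1728` by an INTEGER twist certificate on one model and quadratic-twist transport. For `j = 1728`
(resp. `j = 0`) the curves with the given `j` are QUARTIC (resp. SEXTIC) twists of one another, so no single model suffices; but the
relevant isogeny formula is uniform in the one free coefficient, so no certificate is needed either: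

* §1 `exists_endomorphism_of_smul_eq` — transport of a sign-form endomorphism along a `K`-isomorphism `C • V = E`
  (`Rubin1987.exists_isogeny_bijective_of_smul_eq`; the isomorphism is `Γ_K`-equivariant);
* §2 `a₆_eq_zero_of_j_eq_1728`, `exists_sqrt_endomorphism_of_j_eq_1728` — on a short model `y² = x³ + A x` (`j = 1728 ⟺ B = 0`) the
  IDENTITY `E → E = E^{(-1)}` (`U = X`, `h = 1`, `S = 1`, `T = 0`) is an isogeny formula with twisting data `IsTwistBy (-1)`, whose twist
  by `i` is the automorphism `[i] : (x, y) ↦ (-x, i y)` (Silverman, *Advanced Topics*, II Prop. 2.3.1 (i)); the engine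
  `…SqrtEndomorphism.exists_sqrt_endomorphism` (w1 g5) then gives `ψ` on `V(K̄)` for every `V/K` with `j(V) = 1728`, with
  `σ • ψ P = ψ (σ • P)` for `σ i = i`, `σ • ψ P = -ψ (σ • P)` for `σ i = -i`, and `ψ ∘ ψ = [-1]`;
* §3 `a₄_eq_zero_of_j_eq_zero`, `exists_sqrt_endomorphism_of_j_eq_zero` — on `y² = x³ + B` (`j = 0 ⟺ A = 0`) Vélu's `3`-isogeny
  `y² = x³ + B → y² = x³ - 27 B = E^{(-3)}`, `(x, y) ↦ ((x³ + 4B)/x², y (x³ - 8B)/x³)` (`U = X³ + 4B`, `h = X`, `S = X³ - 8B`, `T = 0`;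
  kernel `{O, (0, ±√B)}`; the tree's `SqrtThree.veluFormula` is the case `B = c²`) has `IsTwistBy (-3)` and `U`, `h` coprime, whence
  `ψ = [√-3]` with `ψ ∘ ψ = [-3]` on every `V/K` with `j(V) = 0`;
* §4 `exists_sqrt_endomorphism_of_j_eq_1728'`, `…_of_j_eq_zero'` — the same with `ψ ∘ ψ = [d_K]`, `d_K = -4` (`ψ ↦ 2ψ`, `r = 2i`)
  resp. `d_K = -3`, i.e. in the normalisation `cmFieldDiscrOfJ` of `…SqrtEndomorphismTwist.exists_sqrt_endomorphism_of_j_mem`.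

THEOREMS ONLY (no definition, no named fact, no instance, no `sorry`; the two isogeny formulae are built inline); nothing about V2/V4 or
any case of BSD is asserted; BSD is not proved by any of this. Supports stmt-BirchSwinnertonDyer-21341 as a helper.

References: [SilvermanAdvancedTopics1994] II §2 Prop. II.2.3.1 (i), Thm. II.2.2(b); [SilvermanAEC2009] III.1 Prop. 1.4, III.4.8,
Remark III.4.13.3 (Vélu), Cor. III.6.3, X.5 Prop. 5.4; J. Vélu, C. R. Acad. Sci. Paris 273 (1971) A238–A241.
-/

noncomputable section

open scoped Classical

open Polynomial WeierstrassCurve Field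
  Literature.NumberTheory.EllipticCurves
  Summit.BirchSwinnertonDyer.BirchSwinnertonDyer.Theorems.BiquadraticEisensteinDescentEisensteinHeartFlatCMInertBadKPrimeSqrtEndomorphism

namespace Summit.BirchSwinnertonDyer.BirchSwinnertonDyer.Theorems.BiquadraticEisensteinDescentEisensteinHeartFlatCMInertBadKPrimeSqrtEndomorphismJ0J1728

universe u

variable {K : Type u} [Field K]

/-! ## §1 Transport along a `K`-isomorphism -/

section Transport

/-- **Transport of a sign-form endomorphism along a `K`-isomorphism.** If `C • V = E` for a change of variables `C` over `K` and `E(K̄)`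
carries an additive `ψ` commuting with the `σ ∈ Γ_K` fixing `r`, anti-commuting with those negating `r`, and with `ψ ∘ ψ = [d]`, then so
does `V(K̄)`: `f = e⁻¹ ψ e` for the `Γ_K`-equivariant bijection `e : V(K̄) ≃ E(K̄)` of `C`. [cite: SilvermanAEC2009, III.3.1(b) and III.4.8] -/
theorem exists_endomorphism_of_smul_eq {V E : WeierstrassCurve K} [V.IsElliptic] [E.IsElliptic] (C : VariableChange K)
    (hC : C • V = E) {B : Type*} [AddGroup B] [DistribMulAction (absoluteGaloisGroup K) B] (r : B) {d : ℤ}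
    (ψ : E.geomPoints →+ E.geomPoints)
    (hψU : ∀ σ : absoluteGaloisGroup K, σ • r = r → ∀ P, σ • ψ P = ψ (σ • P))
    (hψU' : ∀ σ : absoluteGaloisGroup K, σ • r = -r → ∀ P, σ • ψ P = -ψ (σ • P))
    (hψ2 : ∀ P, ψ (ψ P) = d • P) :
    ∃ f : V.geomPoints →+ V.geomPoints,
      (∀ σ : absoluteGaloisGroup K, σ • r = r → ∀ P, σ • f P = f (σ • P)) ∧
      (∀ σ : absoluteGaloisGroup K, σ • r = -r → ∀ P, σ • f P = -f (σ • P)) ∧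
      (∀ P, f (f P) = d • P) := by
  obtain ⟨ι, hι⟩ := Rubin1987.exists_isogeny_bijective_of_smul_eq C hC
  let e : V.geomPoints ≃+ E.geomPoints := AddEquiv.ofBijective ι.toAddMonoidHom hι
  have he : ∀ Q, e Q = ι Q := fun _ ↦ rfl
  have heσ : ∀ (σ : absoluteGaloisGroup K) (Q : V.geomPoints), e (σ • Q) = σ • e Q :=
    fun σ Q ↦ by rw [he, he, ι.map_smul]
  have heσ' : ∀ (σ : absoluteGaloisGroup K) (Y : E.geomPoints), e.symm (σ • Y) = σ • e.symm Y := fun σ Y ↦ by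
    apply e.injective; rw [e.apply_symm_apply, heσ, e.apply_symm_apply]
  refine ⟨e.symm.toAddMonoidHom.comp (ψ.comp e.toAddMonoidHom), fun σ hσ P ↦ ?_, fun σ hσ P ↦ ?_, fun P ↦ ?_⟩
  · change σ • e.symm (ψ (e P)) = e.symm (ψ (e (σ • P)))
    rw [← heσ', hψU σ hσ, heσ]
  · change σ • e.symm (ψ (e P)) = -e.symm (ψ (e (σ • P)))
    rw [← heσ', hψU' σ hσ, heσ, map_neg]
  · change e.symm (ψ (e (e.symm (ψ (e P))))) = d • P
    rw [e.apply_symm_apply, hψ2, map_zsmul, e.symm_apply_apply]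

end Transport

/-! ## §2 `j = 1728`: the identity `y² = x³ + A x → E^{(-1)}` and `[i]` -/

section J1728

variable [CharZero K]

/-- On a short model `y² = x³ + A x + B` (elliptic), `j = 1728` forces `B = 0` (`j = 6912A³/(4A³ + 27B²)`; characteristic `0`).
[cite: SilvermanAEC2009, X.5 Prop. 5.4 (ii)] -/
theorem a₆_eq_zero_of_j_eq_1728 (S : WeierstrassCurve K) [S.IsElliptic] [S.IsShortNF] (hj : S.j = 1728) : S.a₆ = 0 := by
  have hD := four_mul_a₄_cube_add_ne_zero S
  rw [j_of_isShortNF, div_eq_iff hD] at hj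
  have h : (46656 : K) * S.a₆ ^ 2 = 0 := by linear_combination -hj
  have h46656 : (46656 : K) ≠ 0 := by norm_num
  simpa [h46656] using h

/-- On a short model with `j = 1728`, `A ≠ 0`. [cite: SilvermanAEC2009, X.5 Prop. 5.4 (ii)] -/
theorem a₄_ne_zero_of_j_eq_1728 (S : WeierstrassCurve K) [S.IsElliptic] [S.IsShortNF] (hj : S.j = 1728) : S.a₄ ≠ 0 :=
  a₄_ne_zero_of_j_ne_zero S (by rw [hj]; norm_num)

/-- **`[i]` in sign form on `y² = x³ + A x` over `K ∌ i`.** For `E/K` elliptic in short normal form with `a₆ = 0`, `r ∈ K̄` with `r² = -1`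
and `σ₀ ∈ Γ_K` with `σ₀ r = -r`: an additive `ψ` on `E(K̄)` with `σ • ψ P = ψ (σ • P)` for `σ r = r`, `σ • ψ P = -ψ (σ • P)` for
`σ r = -r`, and `ψ (ψ P) = -P`. The isogeny formula is the identity `E → E = E^{(-1)}` (`U = X`, `h = 1`, `S = 1`, `T = 0`; twisting
data `IsTwistBy (-1)` since `a₆ = 0`), whose twist by `r = i` is `[i] : (x, y) ↦ (-x, i y)`.
[cite: SilvermanAdvancedTopics1994, II §2, Prop. II.2.3.1 (i)] [cite: SilvermanAEC2009, Cor. III.6.3] -/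
theorem exists_sqrt_endomorphism_of_isShortNF_of_a₆_eq_zero (E : WeierstrassCurve K) [E.IsElliptic] [E.IsShortNF] (h6 : E.a₆ = 0)
    (r : AlgebraicClosure K) (hr : r ^ 2 = -1) (σ₀ : absoluteGaloisGroup K) (hσ₀ : σ₀ • r = -r) :
    ∃ ψ : E.geomPoints →+ E.geomPoints,
      (∀ σ : absoluteGaloisGroup K, σ • r = r → ∀ P, σ • ψ P = ψ (σ • P)) ∧
      (∀ σ : absoluteGaloisGroup K, σ • r = -r → ∀ P, σ • ψ P = -ψ (σ • P)) ∧
      (∀ P, ψ (ψ P) = (-1 : ℤ) • P) := by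
  have h1 : E.a₁ = 0 := a₁_of_isShortNF E
  have h2 : E.a₂ = 0 := a₂_of_isShortNF E
  have h3 : E.a₃ = 0 := a₃_of_isShortNF E
  let φ : IsogenyFormula E E :=
    { U := X
      h := 1
      S := 1
      T := 0
      identity₁ := by simp only [h1, h3, map_zero, zero_mul, mul_zero, add_zero]
      identity₀ := by
        simp only [h1, h2, h3, h6, map_zero, zero_mul, mul_zero, add_zero, one_pow, mul_one, one_mul,
          zero_pow two_ne_zero, zero_sub]
      h_ne_zero := one_ne_zero
      natDegree_lt := by rw [one_pow, natDegree_one, natDegree_X]; exact Nat.zero_lt_one }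
  have H : φ.IsTwistBy (-1 : K) :=
    { a₁ := h1, a₂ := h2, a₃ := h3, a₁' := h1, a₂' := h2, a₃' := h3
      a₄' := by ring
      a₆' := by rw [h6]; ring
      T := rfl }
  have hcop : IsCoprime φ.U φ.h := isCoprime_one_right
  have hr' : r ^ 2 = algebraMap K (AlgebraicClosure K) (-1 : K) := by rw [hr, map_neg, map_one]
  have hr0 : r ≠ 0 := by rintro rfl; norm_num at hr
  obtain ⟨ψ, hU, hU', h2ψ⟩ := exists_sqrt_endomorphism φ H hcop r hr' hr0 σ₀ hσ₀
  refine ⟨ψ, hU, hU', fun P ↦ ?_⟩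
  rw [h2ψ P, show φ.U = X from rfl, natDegree_X, Nat.cast_one, neg_one_zsmul, one_zsmul]

/-- **`[i]` in sign form on EVERY elliptic curve with `j = 1728` over `K ∌ i`** (`char K = 0`): for `V/K` with `j(V) = 1728`, `r ∈ K̄` with
`r² = -1` and `σ₀ ∈ Γ_K` with `σ₀ r = -r`, an additive `ψ` on `V(K̄)` with the two Galois sign rules and `ψ (ψ P) = -P`. (`V` is
`K`-isomorphic to its short model `y² = x³ + A x`, Mathlib `toShortNF`; §1 + the previous theorem.)
[cite: SilvermanAdvancedTopics1994, II §2, Prop. II.2.3.1 (i) and Thm. II.2.2(b)] [cite: SilvermanAEC2009, X.5 Prop. 5.4 (ii)] -/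
theorem exists_sqrt_endomorphism_of_j_eq_1728 (V : WeierstrassCurve K) [V.IsElliptic] (hj : V.j = 1728)
    (r : AlgebraicClosure K) (hr : r ^ 2 = -1) (σ₀ : absoluteGaloisGroup K) (hσ₀ : σ₀ • r = -r) :
    ∃ ψ : V.geomPoints →+ V.geomPoints,
      (∀ σ : absoluteGaloisGroup K, σ • r = r → ∀ P, σ • ψ P = ψ (σ • P)) ∧
      (∀ σ : absoluteGaloisGroup K, σ • r = -r → ∀ P, σ • ψ P = -ψ (σ • P)) ∧
      (∀ P, ψ (ψ P) = (-1 : ℤ) • P) := by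
  have hjE : (V.toShortNF • V).j = 1728 := by rw [variableChange_j, hj]
  obtain ⟨ψ, h1, h2, h3⟩ := exists_sqrt_endomorphism_of_isShortNF_of_a₆_eq_zero (V.toShortNF • V)
    (a₆_eq_zero_of_j_eq_1728 _ hjE) r hr σ₀ hσ₀
  exact exists_endomorphism_of_smul_eq V.toShortNF rfl r ψ h1 h2 h3

end J1728

/-! ## §3 `j = 0`: Vélu's `3`-isogeny `y² = x³ + B → y² = x³ - 27B = E^{(-3)}` and `[√-3]` -/

section J0

variable [CharZero K]

/-- On a short model `y² = x³ + A x + B` (elliptic), `j = 0` forces `A = 0`. [cite: SilvermanAEC2009, X.5 Prop. 5.4 (iii)] -/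
theorem a₄_eq_zero_of_j_eq_zero (S : WeierstrassCurve K) [S.IsElliptic] [S.IsShortNF] (hj : S.j = 0) : S.a₄ = 0 := by
  have hD := four_mul_a₄_cube_add_ne_zero S
  rw [j_of_isShortNF, div_eq_iff hD, zero_mul] at hj
  have h6912 : (6912 : K) ≠ 0 := by norm_num
  simpa [h6912] using hj

/-- On a short model with `j = 0`, `B ≠ 0`. [cite: SilvermanAEC2009, X.5 Prop. 5.4 (iii)] -/
theorem a₆_ne_zero_of_j_eq_zero (S : WeierstrassCurve K) [S.IsElliptic] [S.IsShortNF] (hj : S.j = 0) : S.a₆ ≠ 0 :=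
  a₆_ne_zero_of_j_ne S (by rw [hj]; norm_num)

/-- **`[√-3]` in sign form on `y² = x³ + B` over `K ∌ √-3`.** For `E/K` elliptic in short normal form with `a₄ = 0`, `r ∈ K̄` with
`r² = -3` and `σ₀ ∈ Γ_K` with `σ₀ r = -r`: an additive `ψ` on `E(K̄)` with `σ • ψ P = ψ (σ • P)` for `σ r = r`, `σ • ψ P = -ψ (σ • P)`
for `σ r = -r`, and `ψ (ψ P) = (-3) • P`. The isogeny formula is Vélu's `3`-isogeny `E → E/⟨(0, ±√B)⟩ : y² = x³ - 27B = E^{(-3)}`,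
`U = X³ + 4B`, `h = X`, `S = X³ - 8B`, `T = 0` (twisting data `IsTwistBy (-3)`; `U`, `h` coprime since `B ≠ 0`).
[cite: SilvermanAdvancedTopics1994, II §2, Prop. II.2.3.1] [cite: SilvermanAEC2009, Remark III.4.13.3 and Cor. III.6.3] -/
theorem exists_sqrt_endomorphism_of_isShortNF_of_a₄_eq_zero (E : WeierstrassCurve K) [E.IsElliptic] [E.IsShortNF] (h4 : E.a₄ = 0)
    (r : AlgebraicClosure K) (hr : r ^ 2 = -3) (σ₀ : absoluteGaloisGroup K) (hσ₀ : σ₀ • r = -r) :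
    ∃ ψ : E.geomPoints →+ E.geomPoints,
      (∀ σ : absoluteGaloisGroup K, σ • r = r → ∀ P, σ • ψ P = ψ (σ • P)) ∧
      (∀ σ : absoluteGaloisGroup K, σ • r = -r → ∀ P, σ • ψ P = -ψ (σ • P)) ∧
      (∀ P, ψ (ψ P) = (-3 : ℤ) • P) := by
  have h1 : E.a₁ = 0 := a₁_of_isShortNF E
  have h2 : E.a₂ = 0 := a₂_of_isShortNF E
  have h3 : E.a₃ = 0 := a₃_of_isShortNF E
  have hB : E.a₆ ≠ 0 := by
    intro hB
    apply E.isUnit_Δ.ne_zero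
    rw [Δ_of_isShortNF, h4, hB]; ring
  set B := E.a₆ with hBdef
  let E' : WeierstrassCurve K := ⟨0, 0, 0, 0, -27 * B⟩
  let φ : IsogenyFormula E E' :=
    { U := X ^ 3 + C (4 * B)
      h := X
      S := X ^ 3 - C (8 * B)
      T := 0
      identity₁ := by simp only [h1, h3, E', map_zero, zero_mul, mul_zero, add_zero]
      identity₀ := by
        simp only [h2, h4, E', map_zero, zero_mul, mul_zero, add_zero, zero_pow two_ne_zero, zero_sub,
          map_mul, map_neg, map_ofNat]
        ring
      h_ne_zero := X_ne_zero
      natDegree_lt := by rw [natDegree_pow, natDegree_X, natDegree_X_pow_add_C]; norm_num }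
  have H : φ.IsTwistBy (-3 : K) :=
    { a₁ := h1, a₂ := h2, a₃ := h3, a₁' := rfl, a₂' := rfl, a₃' := rfl
      a₄' := by change (0 : K) = (-3) ^ 2 * E.a₄; rw [h4, mul_zero]
      a₆' := by change -27 * B = (-3) ^ 3 * E.a₆; rw [← hBdef]; ring
      T := rfl }
  have hcop : IsCoprime φ.U φ.h := by
    have h4B : (4 * B : K) ≠ 0 := mul_ne_zero (by norm_num) hB
    refine ⟨C (4 * B)⁻¹, -(C (4 * B)⁻¹ * X ^ 2), ?_⟩
    change C (4 * B)⁻¹ * (X ^ 3 + C (4 * B)) + -(C (4 * B)⁻¹ * X ^ 2) * X = 1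
    calc C (4 * B)⁻¹ * (X ^ 3 + C (4 * B)) + -(C (4 * B)⁻¹ * X ^ 2) * X = C (4 * B)⁻¹ * C (4 * B) := by ring
      _ = 1 := by rw [← C_mul, inv_mul_cancel₀ h4B, C_1]
  have hr' : r ^ 2 = algebraMap K (AlgebraicClosure K) (-3 : K) := by rw [hr, map_neg, map_ofNat]
  have hr0 : r ≠ 0 := by rintro rfl; norm_num at hr
  obtain ⟨ψ, hU, hU', h2ψ⟩ := exists_sqrt_endomorphism φ H hcop r hr' hr0 σ₀ hσ₀
  refine ⟨ψ, hU, hU', fun P ↦ ?_⟩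
  rw [h2ψ P, show φ.U = X ^ 3 + C (4 * B) from rfl, natDegree_X_pow_add_C]
  norm_num

/-- **`[√-3]` in sign form on EVERY elliptic curve with `j = 0` over `K ∌ √-3`** (`char K = 0`): for `V/K` with `j(V) = 0`, `r ∈ K̄`
with `r² = -3` and `σ₀ ∈ Γ_K` with `σ₀ r = -r`, an additive `ψ` on `V(K̄)` with the two Galois sign rules and `ψ (ψ P) = (-3) • P`.
(`V` is `K`-isomorphic to its short model `y² = x³ + B`; §1 + the previous theorem.)
[cite: SilvermanAdvancedTopics1994, II §2, Prop. II.2.3.1 and Thm. II.2.2(b)] [cite: SilvermanAEC2009, X.5 Prop. 5.4 (iii)] -/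
theorem exists_sqrt_endomorphism_of_j_eq_zero (V : WeierstrassCurve K) [V.IsElliptic] (hj : V.j = 0)
    (r : AlgebraicClosure K) (hr : r ^ 2 = -3) (σ₀ : absoluteGaloisGroup K) (hσ₀ : σ₀ • r = -r) :
    ∃ ψ : V.geomPoints →+ V.geomPoints,
      (∀ σ : absoluteGaloisGroup K, σ • r = r → ∀ P, σ • ψ P = ψ (σ • P)) ∧
      (∀ σ : absoluteGaloisGroup K, σ • r = -r → ∀ P, σ • ψ P = -ψ (σ • P)) ∧
      (∀ P, ψ (ψ P) = (-3 : ℤ) • P) := by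
  have hjE : (V.toShortNF • V).j = 0 := by rw [variableChange_j, hj]
  obtain ⟨ψ, h1, h2, h3⟩ := exists_sqrt_endomorphism_of_isShortNF_of_a₄_eq_zero (V.toShortNF • V)
    (a₄_eq_zero_of_j_eq_zero _ hjE) r hr σ₀ hσ₀
  exact exists_endomorphism_of_smul_eq V.toShortNF rfl r ψ h1 h2 h3

end J0

/-! ## §4 The normalisation `ψ ∘ ψ = [d_K]` (`d_K = -4` at `j = 1728`) -/

section Normalised

variable [CharZero K]

/-- Doubling a sign-form endomorphism: `2ψ = ψ + ψ` has the same sign rules (with respect to `2r` as well as `r`) and `(2ψ)² = [4d]`.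
Used to pass from `[i]` (`r = i`, `d = -1`) to `[2i] = [√-4]` (`r = 2i`, `d = -4 = d_{ℚ(i)}`). [folklore] -/
theorem exists_sqrt_endomorphism_two_mul {V : WeierstrassCurve K} (r : AlgebraicClosure K) {d : ℤ}
    (ψ : V.geomPoints →+ V.geomPoints)
    (hψU : ∀ σ : absoluteGaloisGroup K, σ • r = r → ∀ P, σ • ψ P = ψ (σ • P))
    (hψU' : ∀ σ : absoluteGaloisGroup K, σ • r = -r → ∀ P, σ • ψ P = -ψ (σ • P))
    (hψ2 : ∀ P, ψ (ψ P) = d • P) :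
    ∃ f : V.geomPoints →+ V.geomPoints,
      (∀ σ : absoluteGaloisGroup K, σ • (2 * r) = 2 * r → ∀ P, σ • f P = f (σ • P)) ∧
      (∀ σ : absoluteGaloisGroup K, σ • (2 * r) = -(2 * r) → ∀ P, σ • f P = -f (σ • P)) ∧
      (∀ P, f (f P) = (4 * d) • P) := by
  have h2 : (2 : AlgebraicClosure K) ≠ 0 := two_ne_zero
  have hσ2 : ∀ σ : absoluteGaloisGroup K, σ • (2 * r) = 2 * (σ • r) := fun σ ↦ by
    rw [Field.absoluteGaloisGroup.smul_def, Field.absoluteGaloisGroup.smul_def, map_mul, map_ofNat]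
  refine ⟨ψ + ψ, fun σ hσ P ↦ ?_, fun σ hσ P ↦ ?_, fun P ↦ ?_⟩
  · have hr : σ • r = r := by rw [hσ2] at hσ; exact mul_left_cancel₀ h2 hσ
    rw [AddMonoidHom.add_apply, AddMonoidHom.add_apply, smul_add, hψU σ hr]
  · have hr : σ • r = -r := by rw [hσ2, ← mul_neg] at hσ; exact mul_left_cancel₀ h2 hσ
    rw [AddMonoidHom.add_apply, AddMonoidHom.add_apply, smul_add, hψU' σ hr, neg_add]
  · rw [AddMonoidHom.add_apply, AddMonoidHom.add_apply, map_add, hψ2]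
    module

/-- **`[√-4] = [2i]` in sign form on every elliptic curve with `j = 1728` over `K ∌ i`**, in the normalisation `ψ ∘ ψ = [d_K]`, `d_K = -4`:
for `r ∈ K̄` with `r² = -4` and `σ₀ ∈ Γ_K` with `σ₀ r = -r`, an additive `ψ` on `V(K̄)` with the two sign rules and `ψ (ψ P) = (-4) • P`.
[cite: SilvermanAdvancedTopics1994, II §2, Prop. II.2.3.1 (i) and Thm. II.2.2(b)] -/
theorem exists_sqrt_endomorphism_of_j_eq_1728' (V : WeierstrassCurve K) [V.IsElliptic] (hj : V.j = 1728)
    (r : AlgebraicClosure K) (hr : r ^ 2 = -4) (σ₀ : absoluteGaloisGroup K) (hσ₀ : σ₀ • r = -r) :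
    ∃ ψ : V.geomPoints →+ V.geomPoints,
      (∀ σ : absoluteGaloisGroup K, σ • r = r → ∀ P, σ • ψ P = ψ (σ • P)) ∧
      (∀ σ : absoluteGaloisGroup K, σ • r = -r → ∀ P, σ • ψ P = -ψ (σ • P)) ∧
      (∀ P, ψ (ψ P) = (-4 : ℤ) • P) := by
  have h2 : (2 : AlgebraicClosure K) ≠ 0 := two_ne_zero
  -- `i := r/2`
  set i : AlgebraicClosure K := r / 2 with hidef
  have hri : r = 2 * i := by rw [hidef]; field_simp
  have hi : i ^ 2 = -1 := by
    rw [hidef, div_pow, hr]; norm_num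
  have hσ₀i : σ₀ • i = -i := by
    have h := hσ₀
    rw [hri, Field.absoluteGaloisGroup.smul_def, map_mul, map_ofNat, ← mul_neg] at h
    rw [Field.absoluteGaloisGroup.smul_def]
    exact mul_left_cancel₀ h2 h
  obtain ⟨ψ, h1, h2', h3⟩ := exists_sqrt_endomorphism_of_j_eq_1728 V hj i hi σ₀ hσ₀i
  obtain ⟨f, hf1, hf2, hf3⟩ := exists_sqrt_endomorphism_two_mul i ψ h1 h2' h3
  rw [← hri] at hf1 hf2
  exact ⟨f, hf1, hf2, fun P ↦ by rw [hf3]; norm_num⟩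

end Normalised

end Summit.BirchSwinnertonDyer.BirchSwinnertonDyer.Theorems.BiquadraticEisensteinDescentEisensteinHeartFlatCMInertBadKPrimeSqrtEndomorphismJ0J1728

end
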